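import Summits.KontsevichZagierPeriods.KontsevichZagierPeriods.Theorems.HermiteRigidityReductionRigidityLineReduction
import Summits.KontsevichZagierPeriods.KontsevichZagierPeriods.Theorems.HermiteRigidityReductionRigidityTorusExactness
import Summits.KontsevichZagierPeriods.KontsevichZagierPeriods.Theorems.HermiteRigidityReductionRigidityEulerDescent
import Summits.KontsevichZagierPeriods.KontsevichZagierPeriods.Theorems.HermiteRigidityReductionRigidityBoxPolynomial

/-!
# KontsevichZagierPeriods / HermiteRigidity — crux `ReductionRigidity` (stmt-KontsevichZagierPeriods-3407), line `Sketch` (Padé box island): the BOX reduction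

Route `KontsevichZagierPeriods/HermiteRigidity`, crux stmt-KontsevichZagierPeriods-3407 (`ReductionRigidity`),
crux-chain line `Sketch` (skeleton `Cruxes/ReductionRigidity/Lines/Sketch.lean`). The lead's registered stub
`stub_boxTwoReduction`, PROVED over the landed worker stubs `stub_torusExactness`, `stub_eulerDescent`,
`stub_boxPolynomial` and the line reduction: for every integer `N ≥ 2`, every RESCALED box generator on the
closed unit square `□² = [0,1]²` reduces modulo `KZ.relations` to a normal form with RATIONAL coefficients,

  `[□², q·x^a y^b/(N − xy)^m] ≡ [□², α/(N − xy)] + [□¹, β/(N − x)] + [pt, γ]`,   `α, β, γ ∈ ℚ`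

(values `α·Li₂(1/N) + β·Li₁(1/N) + γ`). Unconditional; only cubical moves with rational primitives regular
on the closed cube (the barrier `noSemialgebraicPrimitive_inv_sub_two` is not met: no variable is integrated
out). Mechanism: torus-equivariant exactness `(a − b)·g = ∂ₓ(x g) − ∂_y(y g)` kills unbalanced monomials;
balanced ones descend in the pole order by Euler's identity `N(m+1)·g_{m+2} = ∂_y(y h) + (m − b)·h` down to
`m = 1`, where the division `(xy)^a = N^a − (N − xy)·Σ_{i<a} N^{a−1−i}(xy)^i` (`balanced_division`) leaves
`N^a/(N − xy)` plus a polynomial, and polynomials are rational constants; then `lineReduction` on the faces.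
Also the normal-form bookkeeping `nf_*` used by the island theorems
(`HermiteRigidityReductionRigidityPadeBoxIslands.lean`).

References: M. Kontsevich, D. Zagier, *Periods* (2001), §1.2 [cite: KontsevichZagier2001, §1.2];
J. Ayoub, *Periods and the conjectures of Grothendieck and Kontsevich–Zagier* (2014), Def. 10 (the
cubical Stokes relation) [cite: Ayoub2014, Def. 10].
-/

noncomputable section

open MeasureTheory Set MvPolynomial

namespace Summit.KontsevichZagierPeriods.HermiteRigidity.ReductionRigidity

open Literature.NumberTheory.Transcendental
open Literature.NumberTheory.Transcendental.KZ

/-! ## Box toolkit -/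

/-- The rescaled box generator `[□², q x^a y^b/(N−xy)^m]` exists. [cite: KontsevichZagier2001, §1.1] -/
theorem exists_boxRep {N : ℕ} (hN : 2 ≤ N) (q : ℚ) (a b m : ℕ) :
    ∃ r : IntegralRep 2, r.domain = cube 2 ∧
      EqOn r.integrand (fun p => (q : ℝ) * (p 0 ^ a * p 1 ^ b) / ((N : ℝ) - p 0 * p 1) ^ m) (cube 2) := by
  refine ⟨(⟨C q * (X 0 ^ a * X 1 ^ b), (C (N : ℚ) - X 0 * X 1) ^ m, eulerDescent_boxDen_ne hN m⟩ : RFun 2).rep, rfl,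
    fun x _ => ?_⟩
  simp [RFun.rep_integrand, RFun.fn]

/-- The box normal form `[□², α/(N−xy)]` exists. [cite: KontsevichZagier2001, §1.1] -/
theorem exists_nf2 {N : ℕ} (hN : 2 ≤ N) (α : ℚ) :
    ∃ s : IntegralRep 2, s.domain = cube 2 ∧
      EqOn s.integrand (fun p => (α : ℝ) / ((N : ℝ) - p 0 * p 1)) (cube 2) := by
  refine ⟨(⟨C α, (C (N : ℚ) - X 0 * X 1) ^ 1, eulerDescent_boxDen_ne hN 1⟩ : RFun 2).rep, rfl, fun x _ => ?_⟩
  simp [RFun.rep_integrand, RFun.fn]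

/-! ## Normal-form bookkeeping (`x ≡ [α/(N−xy)] + [β/(N−x)] + [γ]`, spelled out) -/

/-- Congruence: if `x − y` is a relation and `y` has a rational normal form, so has `x`.
[cite: KontsevichZagier2001, §1.2] -/
theorem nf_congr {N : ℕ} {x y : FormalRep} (hxy : x - y ∈ KZ.relations)
    (hy : ∃ (α β γ : ℚ) (s₂ : IntegralRep 2) (s₁ : IntegralRep 1) (s₀ : IntegralRep 0),
      s₂.domain = cube 2 ∧ EqOn s₂.integrand (fun p => (α : ℝ) / ((N : ℝ) - p 0 * p 1)) (cube 2) ∧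
      s₁.domain = cube 1 ∧ EqOn s₁.integrand (fun p => (β : ℝ) / ((N : ℝ) - p 0)) (cube 1) ∧
      s₀.domain = cube 0 ∧ EqOn s₀.integrand (fun _ => (γ : ℝ)) (cube 0) ∧
      y - (KZ.of s₂ + KZ.of s₁ + KZ.of s₀) ∈ KZ.relations) :
    ∃ (α β γ : ℚ) (s₂ : IntegralRep 2) (s₁ : IntegralRep 1) (s₀ : IntegralRep 0),
      s₂.domain = cube 2 ∧ EqOn s₂.integrand (fun p => (α : ℝ) / ((N : ℝ) - p 0 * p 1)) (cube 2) ∧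
      s₁.domain = cube 1 ∧ EqOn s₁.integrand (fun p => (β : ℝ) / ((N : ℝ) - p 0)) (cube 1) ∧
      s₀.domain = cube 0 ∧ EqOn s₀.integrand (fun _ => (γ : ℝ)) (cube 0) ∧
      x - (KZ.of s₂ + KZ.of s₁ + KZ.of s₀) ∈ KZ.relations := by
  obtain ⟨α, β, γ, s₂, s₁, s₀, hs₂, hs₂i, hs₁, hs₁i, hs₀, hs₀i, h⟩ := hy
  refine ⟨α, β, γ, s₂, s₁, s₀, hs₂, hs₂i, hs₁, hs₁i, hs₀, hs₀i, ?_⟩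
  have : x - (KZ.of s₂ + KZ.of s₁ + KZ.of s₀) = (x - y) + (y - (KZ.of s₂ + KZ.of s₁ + KZ.of s₀)) := by
    abel
  rw [this]
  exact KZ.relations.add_mem hxy h

/-- Sum of rational normal forms (rule 1b on each of the three carriers).
[cite: KontsevichZagier2001, §1.2 rule (1)] -/
theorem nf_add {N : ℕ} (hN : 2 ≤ N) {x y : FormalRep}
    (hx : ∃ (α β γ : ℚ) (s₂ : IntegralRep 2) (s₁ : IntegralRep 1) (s₀ : IntegralRep 0),
      s₂.domain = cube 2 ∧ EqOn s₂.integrand (fun p => (α : ℝ) / ((N : ℝ) - p 0 * p 1)) (cube 2) ∧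
      s₁.domain = cube 1 ∧ EqOn s₁.integrand (fun p => (β : ℝ) / ((N : ℝ) - p 0)) (cube 1) ∧
      s₀.domain = cube 0 ∧ EqOn s₀.integrand (fun _ => (γ : ℝ)) (cube 0) ∧
      x - (KZ.of s₂ + KZ.of s₁ + KZ.of s₀) ∈ KZ.relations)
    (hy : ∃ (α β γ : ℚ) (s₂ : IntegralRep 2) (s₁ : IntegralRep 1) (s₀ : IntegralRep 0),
      s₂.domain = cube 2 ∧ EqOn s₂.integrand (fun p => (α : ℝ) / ((N : ℝ) - p 0 * p 1)) (cube 2) ∧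
      s₁.domain = cube 1 ∧ EqOn s₁.integrand (fun p => (β : ℝ) / ((N : ℝ) - p 0)) (cube 1) ∧
      s₀.domain = cube 0 ∧ EqOn s₀.integrand (fun _ => (γ : ℝ)) (cube 0) ∧
      y - (KZ.of s₂ + KZ.of s₁ + KZ.of s₀) ∈ KZ.relations) :
    ∃ (α β γ : ℚ) (s₂ : IntegralRep 2) (s₁ : IntegralRep 1) (s₀ : IntegralRep 0),
      s₂.domain = cube 2 ∧ EqOn s₂.integrand (fun p => (α : ℝ) / ((N : ℝ) - p 0 * p 1)) (cube 2) ∧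
      s₁.domain = cube 1 ∧ EqOn s₁.integrand (fun p => (β : ℝ) / ((N : ℝ) - p 0)) (cube 1) ∧
      s₀.domain = cube 0 ∧ EqOn s₀.integrand (fun _ => (γ : ℝ)) (cube 0) ∧
      (x + y) - (KZ.of s₂ + KZ.of s₁ + KZ.of s₀) ∈ KZ.relations := by
  obtain ⟨α, β, γ, s₂, s₁, s₀, hs₂, hs₂i, hs₁, hs₁i, hs₀, hs₀i, h⟩ := hx
  obtain ⟨α', β', γ', t₂, t₁, t₀, ht₂, ht₂i, ht₁, ht₁i, ht₀, ht₀i, h'⟩ := hy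
  obtain ⟨hA2, hA1, hA0⟩ := nf_families_additive N
  obtain ⟨u₂, hu₂, hu₂i⟩ := exists_nf2 hN (α + α')
  obtain ⟨u₁, hu₁, hu₁i⟩ := exists_nf1 hN (β + β')
  obtain ⟨u₀, hu₀, hu₀i⟩ := exists_nf0 (γ + γ')
  have e₂ := carrier_add (D := cube 2) (fun α p => (α : ℝ) / ((N : ℝ) - p 0 * p 1)) hA2
    hs₂ hs₂i ht₂ ht₂i hu₂ hu₂i
  have e₁ := carrier_add (D := cube 1) (fun β p => (β : ℝ) / ((N : ℝ) - p 0)) hA1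
    hs₁ hs₁i ht₁ ht₁i hu₁ hu₁i
  have e₀ := carrier_add (D := cube 0) (fun γ _ => (γ : ℝ)) hA0 hs₀ hs₀i ht₀ ht₀i hu₀ hu₀i
  refine ⟨α + α', β + β', γ + γ', u₂, u₁, u₀, hu₂, hu₂i, hu₁, hu₁i, hu₀, hu₀i, ?_⟩
  have : x + y - (KZ.of u₂ + KZ.of u₁ + KZ.of u₀) =
      (x - (KZ.of s₂ + KZ.of s₁ + KZ.of s₀)) + (y - (KZ.of t₂ + KZ.of t₁ + KZ.of t₀))
        - (KZ.of u₂ - KZ.of s₂ - KZ.of t₂) - (KZ.of u₁ - KZ.of s₁ - KZ.of t₁)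
        - (KZ.of u₀ - KZ.of s₀ - KZ.of t₀) := by abel
  rw [this]
  exact KZ.relations.sub_mem (KZ.relations.sub_mem (KZ.relations.sub_mem
    (KZ.relations.add_mem h h') e₂) e₁) e₀

/-- Negative of a rational normal form. [cite: KontsevichZagier2001, §1.2 rule (1)] -/
theorem nf_neg {N : ℕ} (hN : 2 ≤ N) {x : FormalRep}
    (hx : ∃ (α β γ : ℚ) (s₂ : IntegralRep 2) (s₁ : IntegralRep 1) (s₀ : IntegralRep 0),
      s₂.domain = cube 2 ∧ EqOn s₂.integrand (fun p => (α : ℝ) / ((N : ℝ) - p 0 * p 1)) (cube 2) ∧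
      s₁.domain = cube 1 ∧ EqOn s₁.integrand (fun p => (β : ℝ) / ((N : ℝ) - p 0)) (cube 1) ∧
      s₀.domain = cube 0 ∧ EqOn s₀.integrand (fun _ => (γ : ℝ)) (cube 0) ∧
      x - (KZ.of s₂ + KZ.of s₁ + KZ.of s₀) ∈ KZ.relations) :
    ∃ (α β γ : ℚ) (s₂ : IntegralRep 2) (s₁ : IntegralRep 1) (s₀ : IntegralRep 0),
      s₂.domain = cube 2 ∧ EqOn s₂.integrand (fun p => (α : ℝ) / ((N : ℝ) - p 0 * p 1)) (cube 2) ∧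
      s₁.domain = cube 1 ∧ EqOn s₁.integrand (fun p => (β : ℝ) / ((N : ℝ) - p 0)) (cube 1) ∧
      s₀.domain = cube 0 ∧ EqOn s₀.integrand (fun _ => (γ : ℝ)) (cube 0) ∧
      (-x) - (KZ.of s₂ + KZ.of s₁ + KZ.of s₀) ∈ KZ.relations := by
  obtain ⟨α, β, γ, s₂, s₁, s₀, hs₂, hs₂i, hs₁, hs₁i, hs₀, hs₀i, h⟩ := hx
  obtain ⟨hA2, hA1, hA0⟩ := nf_families_additive N
  obtain ⟨t₂, ht₂, ht₂i⟩ := exists_nf2 hN (-α)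
  obtain ⟨t₁, ht₁, ht₁i⟩ := exists_nf1 hN (-β)
  obtain ⟨t₀, ht₀, ht₀i⟩ := exists_nf0 (-γ)
  obtain ⟨u₂, hu₂, hu₂i⟩ := exists_nf2 hN (α + -α)
  obtain ⟨u₁, hu₁, hu₁i⟩ := exists_nf1 hN (β + -β)
  obtain ⟨u₀, hu₀, hu₀i⟩ := exists_nf0 (γ + -γ)
  have e₂ := carrier_add (D := cube 2) (fun α p => (α : ℝ) / ((N : ℝ) - p 0 * p 1)) hA2
    hs₂ hs₂i ht₂ ht₂i hu₂ hu₂i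
  have e₁ := carrier_add (D := cube 1) (fun β p => (β : ℝ) / ((N : ℝ) - p 0)) hA1
    hs₁ hs₁i ht₁ ht₁i hu₁ hu₁i
  have e₀ := carrier_add (D := cube 0) (fun γ _ => (γ : ℝ)) hA0 hs₀ hs₀i ht₀ ht₀i hu₀ hu₀i
  have z₂ : KZ.of u₂ ∈ KZ.relations :=
    carrier_zero (D := cube 2) (fun α p => (α : ℝ) / ((N : ℝ) - p 0 * p 1)) (fun x => by simp) hu₂
      (by rw [add_neg_cancel] at hu₂i; exact hu₂i)
  have z₁ : KZ.of u₁ ∈ KZ.relations :=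
    carrier_zero (D := cube 1) (fun β p => (β : ℝ) / ((N : ℝ) - p 0)) (fun x => by simp) hu₁
      (by rw [add_neg_cancel] at hu₁i; exact hu₁i)
  have z₀ : KZ.of u₀ ∈ KZ.relations :=
    carrier_zero (D := cube 0) (fun γ _ => (γ : ℝ)) (fun x => by simp) hu₀
      (by rw [add_neg_cancel] at hu₀i; exact hu₀i)
  refine ⟨-α, -β, -γ, t₂, t₁, t₀, ht₂, ht₂i, ht₁, ht₁i, ht₀, ht₀i, ?_⟩
  have : -x - (KZ.of t₂ + KZ.of t₁ + KZ.of t₀) =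
      -(x - (KZ.of s₂ + KZ.of s₁ + KZ.of s₀))
        + (KZ.of u₂ - KZ.of s₂ - KZ.of t₂) + (KZ.of u₁ - KZ.of s₁ - KZ.of t₁)
        + (KZ.of u₀ - KZ.of s₀ - KZ.of t₀) - KZ.of u₂ - KZ.of u₁ - KZ.of u₀ := by abel
  rw [this]
  exact KZ.relations.sub_mem (KZ.relations.sub_mem (KZ.relations.sub_mem
    (KZ.relations.add_mem (KZ.relations.add_mem (KZ.relations.add_mem
      (KZ.relations.neg_mem h) e₂) e₁) e₀) z₂) z₁) z₀

/-- A line normal form `[β/(N−x)] + [γ]` is a normal form (with `α = 0`).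
[cite: KontsevichZagier2001, §1.2 rule (1)] -/
theorem nf_of_line {N : ℕ} (hN : 2 ≤ N) {x : FormalRep}
    (hx : ∃ (β γ : ℚ) (s₁ : IntegralRep 1) (s₀ : IntegralRep 0),
      s₁.domain = cube 1 ∧ EqOn s₁.integrand (fun p => (β : ℝ) / ((N : ℝ) - p 0)) (cube 1) ∧
      s₀.domain = cube 0 ∧ EqOn s₀.integrand (fun _ => (γ : ℝ)) (cube 0) ∧
      x - (KZ.of s₁ + KZ.of s₀) ∈ KZ.relations) :
    ∃ (α β γ : ℚ) (s₂ : IntegralRep 2) (s₁ : IntegralRep 1) (s₀ : IntegralRep 0),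
      s₂.domain = cube 2 ∧ EqOn s₂.integrand (fun p => (α : ℝ) / ((N : ℝ) - p 0 * p 1)) (cube 2) ∧
      s₁.domain = cube 1 ∧ EqOn s₁.integrand (fun p => (β : ℝ) / ((N : ℝ) - p 0)) (cube 1) ∧
      s₀.domain = cube 0 ∧ EqOn s₀.integrand (fun _ => (γ : ℝ)) (cube 0) ∧
      x - (KZ.of s₂ + KZ.of s₁ + KZ.of s₀) ∈ KZ.relations := by
  obtain ⟨β, γ, s₁, s₀, hs₁, hs₁i, hs₀, hs₀i, h⟩ := hx
  obtain ⟨s₂, hs₂, hs₂i⟩ := exists_nf2 hN 0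
  have z₂ : KZ.of s₂ ∈ KZ.relations :=
    carrier_zero (D := cube 2) (fun α p => (α : ℝ) / ((N : ℝ) - p 0 * p 1)) (fun x => by simp) hs₂ hs₂i
  refine ⟨0, β, γ, s₂, s₁, s₀, hs₂, hs₂i, hs₁, hs₁i, hs₀, hs₀i, ?_⟩
  have : x - (KZ.of s₂ + KZ.of s₁ + KZ.of s₀) = (x - (KZ.of s₁ + KZ.of s₀)) - KZ.of s₂ := by abel
  rw [this]
  exact KZ.relations.sub_mem h z₂

/-- A rational constant `[pt, γ]` congruence class is a normal form (with `α = β = 0`).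
[cite: KontsevichZagier2001, §1.2 rule (1)] -/
theorem nf_of_const {N : ℕ} (hN : 2 ≤ N) {x : FormalRep}
    (hx : ∃ (γ : ℚ) (s₀ : IntegralRep 0), s₀.domain = cube 0 ∧
      EqOn s₀.integrand (fun _ => (γ : ℝ)) (cube 0) ∧ x - KZ.of s₀ ∈ KZ.relations) :
    ∃ (α β γ : ℚ) (s₂ : IntegralRep 2) (s₁ : IntegralRep 1) (s₀ : IntegralRep 0),
      s₂.domain = cube 2 ∧ EqOn s₂.integrand (fun p => (α : ℝ) / ((N : ℝ) - p 0 * p 1)) (cube 2) ∧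
      s₁.domain = cube 1 ∧ EqOn s₁.integrand (fun p => (β : ℝ) / ((N : ℝ) - p 0)) (cube 1) ∧
      s₀.domain = cube 0 ∧ EqOn s₀.integrand (fun _ => (γ : ℝ)) (cube 0) ∧
      x - (KZ.of s₂ + KZ.of s₁ + KZ.of s₀) ∈ KZ.relations := by
  obtain ⟨γ, s₀, hs₀, hs₀i, h⟩ := hx
  obtain ⟨s₁, hs₁, hs₁i⟩ := exists_nf1 hN 0
  have z₁ : KZ.of s₁ ∈ KZ.relations :=
    carrier_zero (D := cube 1) (fun β p => (β : ℝ) / ((N : ℝ) - p 0)) (fun x => by simp) hs₁ hs₁i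
  refine nf_of_line hN ⟨0, γ, s₁, s₀, hs₁, hs₁i, hs₀, hs₀i, ?_⟩
  have : x - (KZ.of s₁ + KZ.of s₀) = (x - KZ.of s₀) - KZ.of s₁ := by abel
  rw [this]
  exact KZ.relations.sub_mem h z₁

/-! ## The box reduction: induction on the pole order -/

/-- **The balanced division identity** on the square: for `u = xy`,
`q·u^a/(N − u) = q N^a/(N − u) − q·Σ_{i<a} N^{a−1−i} u^i` (from `u^a − N^a = (u − N)·Σ u^i N^{a−1−i}`).
[folklore] -/
theorem balanced_division (N : ℕ) (q : ℚ) (a : ℕ) {p : Fin 2 → ℝ} (hp : (N : ℝ) - p 0 * p 1 ≠ 0) :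
    (q : ℝ) * (p 0 ^ a * p 1 ^ a) / ((N : ℝ) - p 0 * p 1) ^ 1 =
      ((q * (N : ℚ) ^ a : ℚ) : ℝ) / ((N : ℝ) - p 0 * p 1) +
        (aeval p (-(C q * ∑ i ∈ Finset.range a, C ((N : ℚ) ^ (a - 1 - i)) * (X 0 * X 1) ^ i) :
          MvPolynomial (Fin 2) ℚ) : ℝ) := by
  have hgeom := geom_sum₂_mul (p 0 * p 1) (N : ℝ) a
  simp only [map_neg, map_mul, aeval_C, eq_ratCast, map_sum, map_pow, aeval_X, Rat.cast_natCast]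
  have hS : (∑ x ∈ Finset.range a, (N : ℝ) ^ (a - 1 - x) * (p 0 * p 1) ^ x) =
      ∑ i ∈ Finset.range a, (p 0 * p 1) ^ i * (N : ℝ) ^ (a - 1 - i) :=
    Finset.sum_congr rfl fun i _ => mul_comm _ _
  rw [hS, pow_one, ← mul_pow]
  push_cast
  rw [div_add' _ _ _ hp, div_eq_div_iff hp hp]
  linear_combination (-(q : ℝ)) * ((N : ℝ) - p 0 * p 1) * hgeom

/-- **The box reduction** (the lead's stub `stub_boxTwoReduction`, proved; pole order first for the
induction): every rescaled box generator reduces to the three normal forms with RATIONAL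
coefficients, `[q x^a y^b/(N−xy)^m] ≡ [α/(N−xy)] + [β/(N−x)] + [γ]`. Unbalanced (`a ≠ b`): torus
exactness, then the line reduction twice. Balanced: `m = 0` polynomial; `m = 1` the division
identity (normal form + polynomial); `m = k+2` Euler descent to `m = k+1` plus a line generator.
[cite: KontsevichZagier2001, §1.2] -/
theorem boxTwoReduction_aux {N : ℕ} (hN : 2 ≤ N) : ∀ (m : ℕ) (q : ℚ) (a b : ℕ) (r : IntegralRep 2),
    r.domain = cube 2 →
    EqOn r.integrand (fun p => (q : ℝ) * (p 0 ^ a * p 1 ^ b) / ((N : ℝ) - p 0 * p 1) ^ m) (cube 2) →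
    ∃ (α β γ : ℚ) (s₂ : IntegralRep 2) (s₁ : IntegralRep 1) (s₀ : IntegralRep 0),
      s₂.domain = cube 2 ∧ EqOn s₂.integrand (fun p => (α : ℝ) / ((N : ℝ) - p 0 * p 1)) (cube 2) ∧
      s₁.domain = cube 1 ∧ EqOn s₁.integrand (fun p => (β : ℝ) / ((N : ℝ) - p 0)) (cube 1) ∧
      s₀.domain = cube 0 ∧ EqOn s₀.integrand (fun _ => (γ : ℝ)) (cube 0) ∧
      KZ.of r - (KZ.of s₂ + KZ.of s₁ + KZ.of s₀) ∈ KZ.relations := by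
  intro m
  induction m using Nat.strong_induction_on with
  | _ m ih =>
  intro q a b r hr hri
  by_cases hab : a = b
  · subst hab
    rcases m with _ | _ | k
    · -- `m = 0`: a polynomial integrand
      refine nf_of_const hN (stub_boxPolynomial (C q * (X 0 ^ a * X 1 ^ a)) r hr fun p hp => ?_)
      rw [hri hp]
      simp
    · -- `m = 1`: the division `(xy)^a = N^a − (N − xy)·Σ N^{a−1−i}(xy)^i`
      set Q : MvPolynomial (Fin 2) ℚ :=
        -(C q * ∑ i ∈ Finset.range a, C ((N : ℚ) ^ (a - 1 - i)) * (X 0 * X 1) ^ i) with hQ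
      obtain ⟨s₂, hs₂, hs₂i⟩ := exists_nf2 hN (q * (N : ℚ) ^ a)
      set t : IntegralRep 2 := (RFun.poly Q : RFun 2).rep with ht
      have hti : EqOn t.integrand (fun p => (aeval p Q : ℝ)) (cube 2) := fun p _ => by
        simp [ht, RFun.rep_integrand]
      have hsplit : KZ.of r - KZ.of s₂ - KZ.of t ∈ KZ.relations := by
        refine integrandAddRel_subset_relations ⟨2, r, s₂, t, hs₂.trans hr.symm, hr.symm, fun p hp => ?_, rfl⟩
        rw [hr] at hp
        rw [Pi.add_apply, hri hp, hs₂i hp, hti hp, hQ]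
        exact balanced_division N q a (by have := eulerDescent_one_le_sub hN hp; linarith)
      obtain ⟨γ, s₀, hs₀, hs₀i, hts⟩ := stub_boxPolynomial Q t rfl hti
      obtain ⟨s₁, hs₁, hs₁i⟩ := exists_nf1 hN 0
      have z₁ : KZ.of s₁ ∈ KZ.relations :=
        carrier_zero (D := cube 1) (fun β p => (β : ℝ) / ((N : ℝ) - p 0)) (fun x => by simp) hs₁ hs₁i
      refine ⟨q * (N : ℚ) ^ a, 0, γ, s₂, s₁, s₀, hs₂, hs₂i, hs₁, hs₁i, hs₀, hs₀i, ?_⟩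
      have : KZ.of r - (KZ.of s₂ + KZ.of s₁ + KZ.of s₀) =
          (KZ.of r - KZ.of s₂ - KZ.of t) + (KZ.of t - KZ.of s₀) - KZ.of s₁ := by abel
      rw [this]
      exact KZ.relations.sub_mem (KZ.relations.add_mem hsplit hts) z₁
    · -- `m = k + 2`: Euler descent to pole order `k + 1`
      obtain ⟨r₁, hr₁, hr₁i⟩ := exists_lineRep hN (q / ((N : ℚ) * ((k : ℚ) + 1))) a (k + 1)
      obtain ⟨r', hr', hr'i⟩ :=
        exists_boxRep hN (q * ((k : ℚ) - a) / ((N : ℚ) * ((k : ℚ) + 1))) a a (k + 1)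
      have he := stub_eulerDescent N hN q a a k r r₁ r' hr hri hr₁ hr₁i hr' hr'i
      have h₁ := nf_of_line hN (lineReduction hN a _ (k + 1) r₁ hr₁ hr₁i)
      have h' := ih (k + 1) (by omega) _ a a r' hr' hr'i
      refine nf_congr ?_ (nf_add hN h₁ h')
      have : KZ.of r - (KZ.of r₁ + KZ.of r') = KZ.of r - (KZ.of r₁ + KZ.of r') := rfl
      exact he
  · -- unbalanced: torus exactness, then the line reduction twice
    obtain ⟨r₁, hr₁, hr₁i⟩ := exists_lineRep hN (q / ((a : ℚ) - b)) b m
    obtain ⟨r₂, hr₂, hr₂i⟩ := exists_lineRep hN (q / ((a : ℚ) - b)) a m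
    have ht := stub_torusExactness N hN q a b m hab r r₁ r₂ hr hri hr₁ hr₁i hr₂ hr₂i
    have h₁ := nf_of_line hN (lineReduction hN b _ m r₁ hr₁ hr₁i)
    have h₂ := nf_of_line hN (lineReduction hN a _ m r₂ hr₂ hr₂i)
    refine nf_congr ?_ (nf_add hN h₁ (nf_neg hN h₂))
    rwa [← sub_eq_add_neg]

/-- **The box reduction**, the lead's registered stub `stub_boxTwoReduction` (PROVED):
`[q x^a y^b/(N−xy)^m] ≡ [α/(N−xy)] + [β/(N−x)] + [γ]` with `α, β, γ ∈ ℚ`.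
[cite: KontsevichZagier2001, §1.2] -/
theorem stub_boxTwoReduction : ∀ (N : ℕ), 2 ≤ N → ∀ (q : ℚ) (a b m : ℕ) (r : IntegralRep 2),
    r.domain = cube 2 →
    EqOn r.integrand (fun p => (q : ℝ) * (p 0 ^ a * p 1 ^ b) / ((N : ℝ) - p 0 * p 1) ^ m) (cube 2) →
    ∃ (α β γ : ℚ) (s₂ : IntegralRep 2) (s₁ : IntegralRep 1) (s₀ : IntegralRep 0),
      s₂.domain = cube 2 ∧ EqOn s₂.integrand (fun p => (α : ℝ) / ((N : ℝ) - p 0 * p 1)) (cube 2) ∧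
      s₁.domain = cube 1 ∧ EqOn s₁.integrand (fun p => (β : ℝ) / ((N : ℝ) - p 0)) (cube 1) ∧
      s₀.domain = cube 0 ∧ EqOn s₀.integrand (fun _ => (γ : ℝ)) (cube 0) ∧
      KZ.of r - (KZ.of s₂ + KZ.of s₁ + KZ.of s₀) ∈ KZ.relations :=
  fun _ hN q a b m r hr hri => boxTwoReduction_aux hN m q a b r hr hri

end Summit.KontsevichZagierPeriods.HermiteRigidity.ReductionRigidity

end
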